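import Literature.AnabelianGeometry.EtaleTheta.SettingModelSemidirectTopology
import Literature.AnabelianGeometry.EtaleTheta.SettingModelChiCoverings
import Literature.AnabelianGeometry.EtaleTheta.SettingModelChiTwistContinuity
import Literature.AnabelianGeometry.EtaleTheta.SettingModelGalois
import HarnessLib

/-!
# The χ-TWISTED model of the [EtTh] §1 root, part F4: `Π^tp_X := (F̂₂ ×_Ẑ ℤ) ⋊_χ G_{ℚ_p}` as a tempered curve

Mochizuki, *The étale theta function …*, Publ. RIMS **45** (2009) [EtTh], §1, PRIMS PDF pp. 11–12
[cite: MochizukiEtTh2009, §1 p.12]: "`Π^tp_X`", the extension `1 → Δ^tp_X → Π^tp_X → G_K → 1`,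
"`Π_X := (Π^tp_X)^∧`", "`Δ_X` … a profinite free group on 2 generators".  abc-iut cell, layer L2, R78 cluster
(L2-lead RULINGS #13 R100, integrator abc-iut-L6-d6), hand F4 = seat abc-iut-w5-d249.

The finer root model `curve₂` (abc-iut-L2-t1, `SettingModel2Curve.lean`) is `Γ × G_{ℚ_p}` with the DISCRETE Galois
factor — so its Galois group acts trivially on `Δ_Θ` and every Kummer-indexed structure over it is empty
(abc-iut-w5-d171's `SettingModelKummerDataEmpty`).  The χ-TWISTED model replaces the direct product by the
semidirect product along the cyclotomic character: `G_{ℚ_p}` (KRULL topology, `GQp p`) acts on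
`Γ = F̂₂ ×_Ẑ ℤ` by `θ_{χ(σ)}` (`a ↦ a`, `b ↦ b^{χ(σ)}`; abc-iut-w5-d024's `twistGfp`, abc-iut-w5-d091's `chi`,
abc-iut-L2-t1's `actχ := twistGfp ∘ χ`).  This file (consuming those BY NAME, and the generic topology of
`SettingModelSemidirectTopology.lean`):

* `PiTpχ p := Γ ⋊_{actχ} G_{ℚ_p}` with the topology INDUCED along `g ↦ (g.left, g.right)` (`continuous_leftRight`),
  a topological group by the JOINT continuity of the twist (abc-iut-w5-d024's
  `continuous_twistGfp_of_isLocallyConstant` + abc-iut-w5-d091's `isLocallyConstant_levelChar_chi`);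
  `augχ := right` — continuous, OPEN (`isOpenMap_augχ`), onto `G_{ℚ_p}` (`range_augχ`);
* `PiHtχ p := F̂₂ ⋊_{twistHom ∘ χ} G_{ℚ_p}` — compact, Hausdorff, totally disconnected topological group;
  `toHatχ := pr₁ ⋊ id` — continuous, injective, and a PROFINITE COMPLETION (`isProfiniteCompletion_toHatχ`, from
  `isProfiniteCompletion_gfpFst` by the generic `isProfiniteCompletion_mapCont`); `augHatχ := right`;
* `curveχ p : TemperedCurve p` — `K := ℚ_p`, no closed points (as `curve₂`); `deltaHatχ_eq : Δ_X = F̂₂ ⋊ 1`,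
  `deltaHatχEquiv : F̂₂ ≃ₜ* Δ_X`, `isFreeProfiniteOnTwo_deltaHatχ`.

HONEST LABEL: a semi-synthetic model — consistency evidence for the typed interface, NOT the tempered fundamental
group of a curve; nothing of [EtTh] is asserted; nothing here bears on [IUTchIII] Cor. 3.12.  Class (b)
MODEL/CONSTRUCTION file (def-bearing, instances only on the NEW carriers `PiTpχ`, `PiHtχ`).
-/

noncomputable section

namespace Literature.AnabelianGeometry.EtaleTheta.SettingModel

open Literature.AnabelianGeometry.SemiGraphs _root_.Topology _root_.Function

variable (p : ℕ) [Fact p.Prime]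

/-! ### `Π^tp_X := Γ ⋊_χ G_{ℚ_p}` -/

/-- **`Π^tp_X` of the χ-twisted model**: `Γ ⋊_{actχ} G_{ℚ_p}`, `Γ = F̂₂ ×_Ẑ ℤ`, `actχ σ = θ_{χ(σ)} × id`.
[cite: MochizukiEtTh2009, §1 p.12] -/
abbrev PiTpχ : Type := Gfp ⋊[actχ p] GQp p

/-- The topology of `Π^tp_X`: induced along `g ↦ (g.left, g.right) ∈ Γ × G_{ℚ_p}`.
[cite: MochizukiEtTh2009, §1 p.12] -/
instance instTopologicalSpacePiTpχ : TopologicalSpace (PiTpχ p) :=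
  TopologicalSpace.induced (fun g : PiTpχ p => (g.left, g.right)) inferInstance

/-- `g ↦ (g.left, g.right)` is inducing (by definition of the topology). [cite: MochizukiEtTh2009, §1 p.12] -/
theorem isInducing_leftRightχ : IsInducing fun g : PiTpχ p => (g.left, g.right) := ⟨rfl⟩

/-- `g ↦ (g.left, g.right)` is continuous (export for abc-iut-L2-t1's `isOpen_YNχ` / `isOpen_ZNχ`).
[cite: MochizukiEtTh2009, §1 p.12] -/
theorem continuous_leftRight : Continuous fun g : PiTpχ p => (g.left, g.right) :=
  (isInducing_leftRightχ p).continuous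

/-- **The twisting action is jointly continuous**: `(σ, γ) ↦ θ_{χ(σ)} γ` on `G_{ℚ_p} × Γ` (abc-iut-w5-d024's
level-wise argument + local constancy of `χ_N`). [cite: MochizukiEtTh2009, §1 p.12] -/
theorem continuous_actχ : Continuous fun q : GQp p × Gfp => actχ p q.1 q.2 :=
  continuous_twistGfp_of_isLocallyConstant (fun σ => chi p σ) (isLocallyConstant_levelChar_chi p)

/-- **`Π^tp_X` is a topological group.** [cite: MochizukiEtTh2009, §1 p.12] -/
instance instIsTopologicalGroupPiTpχ : IsTopologicalGroup (PiTpχ p) :=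
  Semidirect.isTopologicalGroup_of_continuous_action (isInducing_leftRightχ p) (continuous_actχ p)

/-- `Γ ↪ Π^tp_X` is continuous. [cite: MochizukiEtTh2009, §1 p.12] -/
theorem continuous_inlχ : Continuous (SemidirectProduct.inl : Gfp → PiTpχ p) :=
  Semidirect.continuous_inl (isInducing_leftRightχ p)

/-- The section `G_{ℚ_p} ↪ Π^tp_X` is continuous. [cite: MochizukiEtTh2009, §1 p.12] -/
theorem continuous_inrχ : Continuous (SemidirectProduct.inr : GQp p → PiTpχ p) :=
  Semidirect.continuous_inr (isInducing_leftRightχ p)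

/-- **The augmentation `Π^tp_X → G_{ℚ_p}`** of the χ-twisted model: `g ↦ g.right`. [cite: MochizukiEtTh2009, §1 p.12] -/
def augχ : PiTpχ p →ₜ* GQp p := Semidirect.rightHomCont (isInducing_leftRightχ p)

/-- [cite: MochizukiEtTh2009, §1 p.12] -/
@[simp] theorem augχ_apply (g : PiTpχ p) : augχ p g = g.right := rfl

/-- **The augmentation is an OPEN map** (a coordinate projection; contrast `SettingModelAugNotOpen` for the
discrete-Galois model). [cite: MochizukiEtTh2009, §1 p.12] -/
theorem isOpenMap_augχ : IsOpenMap (augχ p) := Semidirect.isOpenMap_right (isInducing_leftRightχ p)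

/-- The augmentation is onto `G_{ℚ_p} = G_K` (`K = ℚ_p`). [cite: MochizukiEtTh2009, §1 p.12] -/
theorem range_augχ : (augχ p).toMonoidHom.range = ⊤ :=
  MonoidHom.range_eq_top.mpr fun σ => ⟨SemidirectProduct.inr σ, rfl⟩

/-! ### `Π_X := F̂₂ ⋊_χ G_{ℚ_p}` and the completion map -/

/-- The action of `G_{ℚ_p}` on `F̂₂` through `χ`: `σ ↦ θ_{χ(σ)}`. [cite: MochizukiEtTh2009, §1 p.12] -/
abbrev actHatχ : GQp p →* MulAut F₂hatT := twistHom.comp (chi p)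

/-- [cite: MochizukiEtTh2009, §1 p.12] -/
theorem actHatχ_apply (σ : GQp p) (x : F₂hatT) : actHatχ p σ x = twist (chi p σ) x := rfl

/-- **`Π_X` of the χ-twisted model**: `F̂₂ ⋊_{θ ∘ χ} G_{ℚ_p}`. [cite: MochizukiEtTh2009, §1 p.12] -/
abbrev PiHtχ : Type := F₂hatT ⋊[actHatχ p] GQp p

/-- The topology of `Π_X`: induced along `g ↦ (g.left, g.right) ∈ F̂₂ × G_{ℚ_p}`. [cite: MochizukiEtTh2009, §1 p.12] -/
instance instTopologicalSpacePiHtχ : TopologicalSpace (PiHtχ p) :=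
  TopologicalSpace.induced (fun g : PiHtχ p => (g.left, g.right)) inferInstance

/-- [cite: MochizukiEtTh2009, §1 p.12] -/
theorem isInducing_leftRightHatχ : IsInducing fun g : PiHtχ p => (g.left, g.right) := ⟨rfl⟩

/-- [cite: MochizukiEtTh2009, §1 p.12] -/
theorem continuous_leftRightHat : Continuous fun g : PiHtχ p => (g.left, g.right) :=
  (isInducing_leftRightHatχ p).continuous

/-- The action on `F̂₂` is jointly continuous. [cite: MochizukiEtTh2009, §1 p.12] -/
theorem continuous_actHatχ : Continuous fun q : GQp p × F₂hatT => actHatχ p q.1 q.2 :=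
  continuous_twist_of_isLocallyConstant (fun σ => chi p σ) (isLocallyConstant_levelChar_chi p)

/-- `Π_X` is a topological group. [cite: MochizukiEtTh2009, §1 p.12] -/
instance instIsTopologicalGroupPiHtχ : IsTopologicalGroup (PiHtχ p) :=
  Semidirect.isTopologicalGroup_of_continuous_action (isInducing_leftRightHatχ p) (continuous_actHatχ p)

/-- `Π_X` is compact. [cite: MochizukiEtTh2009, §1 p.12] -/
instance instCompactSpacePiHtχ : CompactSpace (PiHtχ p) := by
  haveI := compactSpace_GQp p
  exact Semidirect.compactSpace_of (isInducing_leftRightHatχ p)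

/-- `Π_X` is Hausdorff. [cite: MochizukiEtTh2009, §1 p.12] -/
instance instT2SpacePiHtχ : T2Space (PiHtχ p) := by
  haveI : T2Space (GQp p) := krullTopology_t2
  exact Semidirect.t2Space_of (isInducing_leftRightHatχ p)

/-- `Π_X` is totally disconnected. [cite: MochizukiEtTh2009, §1 p.12] -/
instance instTotallyDisconnectedSpacePiHtχ : TotallyDisconnectedSpace (PiHtχ p) := by
  haveI := totallyDisconnectedSpace_GQp p
  exact Semidirect.totallyDisconnectedSpace_of (isInducing_leftRightHatχ p)

/-- `pr₁ : Γ → F̂₂` intertwines the two actions: `pr₁ (θ_{χσ} γ) = θ_{χσ} (pr₁ γ)`. [cite: MochizukiEtTh2009, §1 p.12] -/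
theorem gfpFst_actχ (σ : GQp p) (γ : Gfp) : gfpFst (actχ p σ γ) = actHatχ p σ (gfpFst γ) := rfl

/-- **`Π^tp_X → Π_X`**: `pr₁ ⋊ id`. [cite: MochizukiEtTh2009, §1 p.12] -/
def toHatχ : PiTpχ p →ₜ* PiHtχ p :=
  Semidirect.mapCont (isInducing_leftRightχ p) (isInducing_leftRightHatχ p) gfpFst (gfpFst_actχ p)

/-- [cite: MochizukiEtTh2009, §1 p.12] -/
@[simp] theorem toHatχ_left (g : PiTpχ p) : (toHatχ p g).left = gfpFst g.left := rfl

/-- [cite: MochizukiEtTh2009, §1 p.12] -/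
@[simp] theorem toHatχ_right (g : PiTpχ p) : (toHatχ p g).right = g.right := rfl

/-- `Π^tp_X → Π_X` is injective ("natural injection"). [cite: MochizukiEtTh2009, §1 p.12] -/
theorem toHatχ_injective : Injective (toHatχ p) :=
  Semidirect.mapCont_injective _ _ _ _ gfpFst_injective

/-- The profinite augmentation `Π_X → G_{ℚ_p}`: `g ↦ g.right`. [cite: MochizukiEtTh2009, §1 p.12] -/
def augHatχ : PiHtχ p →ₜ* GQp p := Semidirect.rightHomCont (isInducing_leftRightHatχ p)

/-- [cite: MochizukiEtTh2009, §1 p.12] -/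
@[simp] theorem augHatχ_apply (g : PiHtχ p) : augHatχ p g = g.right := rfl

/-- `augHat ∘ toHat = aug`. [cite: MochizukiEtTh2009, §1 p.12] -/
theorem augHatχ_toHatχ (g : PiTpχ p) : augHatχ p (toHatχ p g) = augχ p g := rfl

/-- **`Π_X = (Π^tp_X)^∧`**: `pr₁ ⋊ id` is a profinite completion (generic `isProfiniteCompletion_mapCont` at
abc-iut-L2-t1's `isProfiniteCompletion_gfpFst`; each `θ_{χσ}` is continuous). [cite: MochizukiEtTh2009, §1 p.12] -/
theorem isProfiniteCompletion_toHatχ : IsProfiniteCompletion (toHatχ p) := by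
  haveI := compactSpace_GQp p
  haveI : T2Space (GQp p) := krullTopology_t2
  haveI := totallyDisconnectedSpace_GQp p
  exact Semidirect.isProfiniteCompletion_mapCont (isInducing_leftRightχ p) (isInducing_leftRightHatχ p) gfpFst
    (gfpFst_actχ p) isProfiniteCompletion_gfpFst (fun σ => (twist (chi p σ)).continuous)

/-! ### The tempered-curve layer -/

/-- **The tempered-curve layer of the χ-twisted model**: `K := ℚ_p`, `Π^tp := Γ ⋊_χ G_{ℚ_p}`,
`Π := F̂₂ ⋊_χ G_{ℚ_p}`, no closed points (as abc-iut-L2-t1's `curve₂`; a cusp datum on the `b`-axis is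
abc-iut-w5-d029's sequel). [cite: MochizukiEtTh2009, §1 p.11] -/
abbrev curveχ : TemperedCurve p where
  K := ⊥
  finiteDimensional_K := inferInstance
  PiTemp := PiTpχ p
  aug := augχ p
  range_aug := by
    rw [IntermediateField.fixingSubgroup_bot]
    exact range_augχ p
  PiHat := PiHtχ p
  toHat := toHatχ p
  isProfiniteCompletion_toHat := isProfiniteCompletion_toHatχ p
  toHat_injective := toHatχ_injective p
  augHat := augHatχ p
  augHat_comp _ := rfl
  Pt := PEmpty
  IsCusp _ := False
  decomp x := x.elim
  isClosed_decomp x := x.elim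
  isOpen_aug_decomp x := x.elim
  inertia_eq_bot x := x.elim
  inertia_equiv_zHat x := x.elim

/-- `Δ^tp_X = Ker(aug) = {g | g.right = 1} = Γ ⋊ 1`. [cite: MochizukiEtTh2009, §1 p.12] -/
theorem mem_deltaTempχ_iff (g : PiTpχ p) : g ∈ (curveχ p).DeltaTemp ↔ g.right = 1 := Iff.rfl

/-- `inl γ ∈ Δ^tp_X`. [cite: MochizukiEtTh2009, §1 p.12] -/
theorem inl_mem_deltaTempχ (γ : Gfp) : (SemidirectProduct.inl γ : PiTpχ p) ∈ (curveχ p).DeltaTemp :=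
  (mem_deltaTempχ_iff p _).mpr rfl

/-- `Ker(Π_X → G_{ℚ_p})` is closed. [cite: MochizukiEtTh2009, §1 p.12] -/
theorem isClosed_ker_rightHomHatχ :
    IsClosed ((SemidirectProduct.rightHom : PiHtχ p →* GQp p).ker : Set (PiHtχ p)) := by
  haveI : T2Space (GQp p) := krullTopology_t2
  have e : ((SemidirectProduct.rightHom : PiHtχ p →* GQp p).ker : Set (PiHtχ p)) =
      (fun g : PiHtχ p => g.right) ⁻¹' {1} := by
    ext g; simp [MonoidHom.mem_ker, SemidirectProduct.rightHom]
  rw [e]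
  exact isClosed_singleton.preimage (Semidirect.continuous_right (isInducing_leftRightHatχ p))

/-- **`Δ_X = F̂₂ ⋊ 1 = Ker(Π_X → G_{ℚ_p})`** (the image of `Γ` in `F̂₂` is dense). [cite: MochizukiEtTh2009, §1 p.12] -/
theorem deltaHatχ_eq : (curveχ p).DeltaHat = (SemidirectProduct.rightHom : PiHtχ p →* GQp p).ker := by
  apply le_antisymm
  · refine Subgroup.topologicalClosure_minimal _ ?_ (isClosed_ker_rightHomHatχ p)
    rintro _ ⟨g, hg, rfl⟩
    rw [MonoidHom.mem_ker]
    change ((curveχ p).toHat g).right = 1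
    exact (mem_deltaTempχ_iff p g).mp hg
  · intro x hx
    rw [MonoidHom.mem_ker] at hx
    change x.right = 1 at hx
    -- `x = inl x.left`, and `inl x.left ∈ closure (inl '' range pr₁) ⊆ closure (toHat '' Δ^tp)`
    have hxe : x = SemidirectProduct.inl x.left := by
      rw [← SemidirectProduct.inl_left_mul_inr_right x, hx, map_one, mul_one]
      rfl
    have hsub : SemidirectProduct.inl '' Set.range (gfpFst : Gfp → F₂hatT) ⊆
        (((curveχ p).DeltaTemp.map (curveχ p).toHat.toMonoidHom : Subgroup (PiHtχ p)) : Set (PiHtχ p)) := by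
      rintro _ ⟨_, ⟨γ, rfl⟩, rfl⟩
      refine ⟨SemidirectProduct.inl γ, inl_mem_deltaTempχ p γ, ?_⟩
      change toHatχ p (SemidirectProduct.inl γ) = SemidirectProduct.inl (gfpFst γ)
      exact SemidirectProduct.ext rfl rfl
    have hmem : (SemidirectProduct.inl x.left : PiHtχ p) ∈ closure (SemidirectProduct.inl '' Set.range gfpFst) :=
      image_closure_subset_closure_image (Semidirect.continuous_inl (isInducing_leftRightHatχ p))
        ⟨x.left, isProfiniteCompletion_gfpFst.denseRange x.left, rfl⟩
    rw [hxe]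
    have key := closure_mono hsub hmem
    rwa [← Subgroup.topologicalClosure_coe] at key

/-- `(x, 1) ∈ Δ_X`. [cite: MochizukiEtTh2009, §1 p.12] -/
theorem inl_mem_deltaHatχ (x : F₂hatT) : (SemidirectProduct.inl x : PiHtχ p) ∈ (curveχ p).DeltaHat := by
  rw [deltaHatχ_eq, MonoidHom.mem_ker, SemidirectProduct.rightHom_inl]

/-- Elements of `Δ_X` have trivial `G_{ℚ_p}`-component. [cite: MochizukiEtTh2009, §1 p.12] -/
theorem right_eq_one_of_mem_deltaHatχ {x : PiHtχ p} (hx : x ∈ (curveχ p).DeltaHat) : x.right = 1 := by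
  rw [deltaHatχ_eq, MonoidHom.mem_ker] at hx
  exact hx

/-- `Δ_X` is normal in `Π_X`. [cite: MochizukiEtTh2009, §1 p.12] -/
theorem deltaHatχ_normal : (curveχ p).DeltaHat.Normal := by
  rw [deltaHatχ_eq]
  infer_instance

/-- **`Δ_X ≃ₜ* F̂₂`** for the χ-twisted model. [cite: MochizukiEtTh2009, §1 p.12] -/
def deltaHatχEquiv : F₂hatT ≃ₜ* (curveχ p).DeltaHat where
  toFun x := ⟨SemidirectProduct.inl x, inl_mem_deltaHatχ p x⟩
  invFun y := (Subtype.val y).left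
  left_inv x := rfl
  right_inv y := by
    apply Subtype.ext
    change SemidirectProduct.inl (y.1.left) = y.1
    rw [← SemidirectProduct.inl_left_mul_inr_right y.1, right_eq_one_of_mem_deltaHatχ p y.2, map_one, mul_one]
    rfl
  map_mul' x y := Subtype.ext (map_mul _ x y)
  continuous_toFun := (Semidirect.continuous_inl (isInducing_leftRightHatχ p)).subtype_mk _
  continuous_invFun := (Semidirect.continuous_left (isInducing_leftRightHatχ p)).comp continuous_subtype_val

/-- **`Δ_X` of the χ-twisted model is profinite free on two generators** (the twist changes the Galois action,
not `Δ_X = F̂₂`), so `IsEtThOrigin.of_free` applies downstream. [cite: MochizukiEtTh2009, §1 p.12] -/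
theorem isFreeProfiniteOnTwo_deltaHatχ : IsFreeProfiniteOnTwo (curveχ p).DeltaHat :=
  IsFreeProfiniteOnTwo.of_continuousMulEquiv (deltaHatχEquiv p) isFreeProfiniteOnTwo_profiniteCompletion_freeGroup

end Literature.AnabelianGeometry.EtaleTheta.SettingModel

end
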